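import Summits.HodgeConjecture.HodgeConjecture.Theses.EndoscopicMiddleDegree
import Summits.HodgeConjecture.HodgeConjecture.Theorems.NikulinSerreCarrier.Negative.OrientationTwist
import Literature.AlgebraicGeometry.HodgeTheory.ComplexGysinCorrespondence
import Literature.AlgebraicGeometry.HodgeTheory.GysinBaseChangeOfKunneth
import Literature.AlgebraicGeometry.HodgeTheory.AlgebraicClassesExteriorProduct
import Literature.AlgebraicGeometry.HodgeTheory.HardLefschetzThreefold
import Literature.AlgebraicGeometry.HodgeTheory.SupportedClassesRationalProofs

/-!
# Disproof of `OrthogonalEnveloped` — standing adversary's work file (cdisprove; cycle 1, 2026-08-16)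

Crux `stmt-HodgeConjecture-14300` = `EndoscopicMiddleDegree.OrthogonalEnveloped` (route
`route-HodgeConjecture-EndoscopicMiddleDegree`, rev 6, rank 4; deciding path `IsotypicMiddleClassesAlgebraic
→ OrthogonalEnveloped → OrthogonalSplit → OrientationData → CupProductAlgebraic → KernelStep → MiddleDegreeStep →
SectorComplement`). For `μ` an orientation family with Poincaré duality, `m ∈ {1,2}` (`n = m+1`, `dim X = 2n`),
a datum `D : UnitaryBallQuotientDatum (2n) X` and a RATIONAL `(n,n)`-class `e` cup-orthogonal to the theta world
`TW(D) = SCⁿ ⊔ SConⁿ ⊔ Hdg^{m,m}_ℚ·N¹`: there is `γ ∈ algebraicClasses (X ⊗ X) (2n)` whose action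
`P_γ β = pr₁₊(pr₂^* β ∪ γ)` preserves rational classes, has purely `(n,n)` image and fixes `e`.

**NO KILL — and none is possible short of `¬HC` on the sector (finding F1, PROVED here).** Findings, indexed;
prose only in docstrings; everything below is kernel-checked (`lean check` rc 0, no `sorry`) unless marked PAPER.
LANDED (Negative lane, `--supports stmt-HodgeConjecture-14300`): p80733 ACCEPTED 2026-08-16T05:05Z =
`Summits/HodgeConjecture/HodgeConjecture/Theorems/OrthogonalEnveloped/Negative/EnvelopeOfAlgebraic.lean`
(F1/F1′: `exists_normalised_crossSq`, `conclusion_of_mem_algebraicClasses`, `conclusion_of_orthogonalFrame`);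
companion `Negative/NecessaryForTarget.lean` (¬crux ⟹ ¬HC on the sector / ¬`MiddleDegreeStep`; `concl_of_concl`) in
the seat folder, to be filed next (imports the landed file). Ideators/planners/leads: import the landed module.

* **F0 — typing audit: the statement is clean.** `P` is literally the tree's `corrAction μ hX hX rfl γ`
  (`pc_apply`, `rfl`); the scheme-point preorder is `y ≤ z ↔ z ⤳ y` (`Iff.rfl`), so `Order.coheight` IS
  codimension and `algebraicClasses`/`classesSupportedOn`/the `SCon` summand mean what the docstrings say; every
  `∀`-bound object is field-rich (`UnitaryBallQuotientDatum`: `surjOn_unif` + `unif_eq_unif_iff` force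
  `X(ℂ) ≃ₜ Γ\𝔹²ⁿ`, PROVED `homeomorph`; `isSmoothProjective`; special cycles pinned on complex points with
  codimension) — no `PUnit`/zero/empty model, cf. F1 of `Cruxes/MiddleThetaSpan/Disproof.lean`; `IsOfHodgeType`
  is `∃ HodgeModel`, and the hypothesis on `e` supplies the model the conclusion needs (`concl_zero`). An
  UNCONDITIONAL `¬OrthogonalEnveloped` therefore needs a genuine datum, which the tree cannot build.
* **F1 — the crux FOLLOWS FROM the Hodge conjecture on the sector** (`conclusion_of_mem_algebraicClasses`,
  `orthogonalEnveloped_of_middleHC`, `orthogonalEnveloped_of_middleDegreeStep`). For an ALGEBRAIC rational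
  `(n,n)`-class `e` with `e ∪ e ≠ 0`, `γ := (pr₁₊pr₂^*(e∪e))⁻¹ · pr₁^*e ∪ pr₂^*e` is algebraic on `X ⊗ X`
  (exterior products, tree `cupProduct_map_fst_map_snd_mem_supportedClasses`), and
  `P_γ(β) = (⟨β,e⟩/⟨e,e⟩)·e` (`pc_crossSq_apply`: associativity + graded commutativity + `pr₂^*`
  multiplicative + projection formula `complexGysin_cup`) preserves rational classes for EVERY `μ` (the
  orientation scalar cancels in the ratio: comparison with `ratFamily`, `exists_ratCast_eq_of_isRationalClass_smul`),
  has image `ℂ·e` and fixes `e`. The two textbook inputs are explicit hypotheses: `hK` = the fibre integral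
  `pr₁₊pr₂^* : H^{4n}(X) → H⁰(X)` is non-zero (Künneth), `hHR` = `e ∪ e ≠ 0` for non-zero rational `(n,n)`
  `e ⊥ TW(D)` (primitive ⟸ `TW ⊇ L·Hdg^{n-1,n-1}_ℚ`; Hodge–Riemann). With them:
  `(HC in degree 2n on varieties carrying a datum) → OrthogonalEnveloped`, and
  `MiddleDegreeStep → (its own lower-degree hypothesis) → OrthogonalEnveloped`. CONSEQUENCES. (i) A
  refutation of the crux is a non-algebraic rational Hodge class on a compact arithmetic 4- or 6-ball quotient,
  i.e. `¬HC`: no cheap kill exists, ever. (ii) The crux is NECESSARY for the target and, with `KernelStep`,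
  the pair (`OrthogonalEnveloped`, `IsotypicMiddleClassesAlgebraic`) is jointly EQUIVALENT to HC on `TW(D)^⊥`;
  `IsotypicMiddleClassesAlgebraic` is HC-implied too (`P c = c`, `P` `(n,n)`-valued ⟹ `c` is a rational Hodge
  class). All risk of the line is provability, none is truth. (iii) The informal text's "HC on X, X×X ⟹ ENV
  (Lieberman)" is sharpened: HC on `X` in the single degree `2n` suffices, no Lieberman, no HC on `X × X`.
* **F1′ — frames (`conclusion_of_orthogonalFrame`, `exists_normalised_crossSq`, `pc_smul_crossSq_apply`).**
  Summing normalised exterior squares over a cup-ORTHOGONAL frame `f₁,…,f_r` of algebraic rational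
  `(n,n)`-classes with `fᵢ ∪ fᵢ ≠ 0` envelopes every `ℚ`-combination `Σ aᵢ fᵢ` (cross terms vanish). With HC
  in degree `2n` and Hodge–Riemann non-degeneracy on `Hdg_ℚ` (anisotropic orthogonal bases exist for
  non-degenerate `ℚ`-forms) this envelopes EVERY rational Hodge class: `e ⊥ TW(D)` is not needed for truth.
* **F2 — `μ.HasPoincareDuality` is a free hypothesis** (`orthogonalEnveloped_iff_noPD`): it is the tree's
  theorem `OrientationFamily.hasPoincareDuality` (Hatcher 3.30 proved). Likewise `OrientationData` is inhabited
  by ANY family, e.g. `⟨ratFamily, OrientationFamily.hasPoincareDuality _⟩`.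
* **F3 — the `∀ μ : OrientationFamily` quantifier is harmless here** (`concl_iff_of_orientationFamily`), in
  contrast with crux `NikulinSerreCarrier` where it was fatal (`Negative/OrientationTwist`): `corrAction μ' =
  c • corrAction μ` and `γ ↦ c • γ` preserves the `ℂ`-subspace `algebraicClasses`, so the conclusion at one
  family gives it at all. Provers may fix `μ := ratFamily` (rational Gysin maps).
* **F4 — load-bearing hypotheses.** `IsOfHodgeType e`: dropping it is refuted modulo `H_T` (a rational class
  `⊥ TW(D)` not of type `(n,n)`; PAPER: any datum with `H^{2n} ≠ H^{n,n}`) —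
  `withoutHodgeType_false_of_hasTranscendentalOrthClass`. `IsRationalClass e`: dropping it is refuted modulo
  `H_R` (an `(n,n)`-class `⊥ TW(D)` outside `Hdg_ℚ ⊗ ℂ`; PAPER: any datum with a CORE piece, granted HC!) —
  `withoutRational_false_of_hasNonRationalSpanOrthClass` (`P(H) ⊆ Hdg_ℚ ⊗ ℂ` because rational classes span,
  `span_isRationalClass_eq_top_of_isSmoothProjective_holds`). NOT load-bearing for TRUTH (F1's proof never uses
  them beyond `e ∪ e ≠ 0`): the orthogonality `e ⊥ TW(D)` (drop it and envelope by the projector onto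
  `Hdg_ℚ`, non-degenerate by Hodge–Riemann on the Lefschetz pieces — PAPER), the guards `1 ≤ m ≤ 2` (F1 is
  uniform in `m`; at `m = 0` the hypotheses force `e = 0` by Lefschetz (1,1) + Hodge index since
  `SCon⁰ ⊇ N¹H²`), and `μ.HasPoincareDuality` (F2). They are load-bearing only for the route's INTENDED proof.
* **F5 (PAPER) — the intended proof, and where a disprover could still bite.** The route proves the crux with
  `γ` a `ℚ`-combination of Hecke correspondence cycles (`P` = a Hecke idempotent). By Matsushima + AMF
  (Mok; KMSW for inner forms) `H^{2n} = ⊕_ψ ⊕_{π_f} V(π_f) ⊗ π_f^K` and a Hecke element fixing `e` fixes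
  `V ⊗ w` for each component, so: **HeckeEnveloped(e) ⟺ every Hecke-isotypic component of `e` lies in a piece
  `V(π_f)` which is PURE `(n,n)` in degree `2n`.** PURITY COUNT (Adams–Johnson = Arthur at `τ₁`:
  Arancibia–Moeglin–Renard arXiv:1507.01432, Adams–Arancibia–Mezo doi:10.1090/memo/1503 and, for real unitary
  groups, Arancibia–Mezo doi:10.1090/ert/707; cohomological `A_𝔮` of `U(N,1)` and their Hodge types: BMM §2.2
  (held text p. 10, `H^•(𝔤,K;A_𝔮) ≅ Hom_{L∩K}(∧^{•-R}(𝔩∩𝔨), ℂ)`), Bergeron–Clozel doi:10.1007/s00222-012-0415-2; trivial coefficients, coordinates `{n, …, -n}` at `τ₁`): the A-packet member with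
  non-compact slot in an `∞`-block `B` contributes to degree `2n` only if `|B|` is odd, and then exactly the type
  `(n - c_B, n + c_B)`, `c_B` = centre of `B` (it is `A_{q_B}`, `L ⊇ U(|B|-1,1)`, types `(a+k, b+k)`,
  `a`/`b` = coordinates above/below `B`, `k = (|B|-1)/2`). Members sharing `π_f` with the `A(n,n)`-carrier
  (`B₀ ∋ 0`) are those whose `S_ψ`-character agrees, i.e. whose block lies in the SAME global summand
  `μ ⊠ R_b` as `B₀`. Hence `V(π_f) ∋ A(n,n)` is pure `(n,n)` **iff the global summand containing the
  coordinate `0` at `τ₁` is a character** (`χ₀ ⊠ R_b`, `b` odd; `b = 1` for primitive classes): TATE TYPE in the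
  wide sense, `ψ = χ₀ ⊞ ψ'` with `ψ'` ARBITRARY (tempered, `ρ⊠R₂ ⊞ …`, `Ψ₂⊠R₃`, …). Two corrections to the
  item's why-might-fail: (a) at `m = 2` NO non-DS Adams–Johnson member pollutes a Tate-type piece in `H⁶`
  (even blocks miss degree 6; odd blocks `∌ 0` have the other `S_ψ`-character) — the "CAP piece impure in H⁶"
  worry is unfounded; (b) theta-VISIBILITY plays no role in THIS crux: visible or invisible, a pure piece is
  enveloped by its `ℚ`-rational idempotent (semisimplicity: Hecke operators are normal for the Petersson
  product). What remains is exactly **NoImpureRationalComponents**: a rational primitive `(n,n)`-class has no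
  component in a piece whose coordinate-`0` summand has `dim μ ≥ 2` ("cores in the wide sense": stable
  `Ψ_{2n+1}`; `Ψ₄ ⊞ χ₀` with `χ₀` off-centre at EVERY place of the CM type, the coefficient-conjugation sieve
  killing those with a centred conjugate; `Ψ₃ ⊞ Ψ₂`; …). It is implied by HC (+ "Hodge ⟹ Tate": the piece's
  `ℓ`-adic realisation `r(Ψ) ⊗ χ` is irreducible for a density-one set of `ℓ`, Calegari–Gee `n ≤ 5` /
  Patrikis–Taylor, so it has no Tate line) and by nothing less that is in print: it IS the bet
  `CoreVanishing`, now precisely delimited. A disprover cannot refute it without refuting HC; a prover cannot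
  avoid it.
* **F5b (PAPER) — the complete list of "wide cores" the bet must cover.** A piece carries an `(n,n)`-line in
  degree `2n` and is IMPURE iff its block `B₀ ∋ 0` at `τ₁` is centred of odd size `b` inside a global summand
  `μ ⊠ R_b` with `a = dim μ ≥ 2`; since the other `a - 1` blocks of that summand need `3(a-1)` further
  consecutive coordinates, `b ≥ 3` forces `a = 1` at both `N = 5` and `N = 7`. So wide cores have `b = 1`:
  the coordinate `0` at `τ₁` lies in a CUSPIDAL summand `Ψ_a` (`a ≥ 2`, tempered at `0`), the rest of `ψ`
  arbitrary. `m = 1` (`N = 5`): `Ψ₅`; `Ψ₄ ⊞ χ`; `Ψ₃ ⊞ Ψ₂`, `Ψ₃ ⊞ χ ⊞ χ'`; `Ψ₂ ⊞ Ψ₂' ⊞ χ`, `Ψ₂ ⊞ Ψ₃`,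
  `Ψ₂ ⊞ χ ⊞ χ' ⊞ χ''` (with `0 ∈ Ψ_a` at `τ₁`; `ρ ⊠ R₂ ∋ 0` gives an even block, no `(2,2)` at all;
  `χ ⊠ R₃ ∋ 0` is pure and non-primitive). `m = 2` (`N = 7`): `Ψ_a ⊞ ψ'` with `0 ∈ Ψ_a`, `2 ≤ a ≤ 7`, `ψ'`
  of dimension `7 - a` arbitrary — including NON-tempered wide cores such as `Ψ₃ ⊞ ρ ⊠ R₂` (new at `m = 2`).
  The coefficient-conjugation sieve removes exactly those shapes having, at SOME embedding `w` of `E`, the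
  weight `0` inside a character summand (then a conjugate piece has no `(n,n)`-line); what survives the sieve
  — no character summand at all (`Ψ₅`, `Ψ₃ ⊞ Ψ₂`, `Ψ₇`, `Ψ₄ ⊞ Ψ₃`, `Ψ₃ ⊞ ρ⊠R₂`, …) or every character
  summand off-centre at every `w` — is the precise domain of `CoreVanishing`. Rational Hodge classes there
  contradict HC + Tate (irreducible `r(Ψ_a)`-factor of dimension `a ≥ 2` tensored through the piece).
* **F6 (PAPER) — natural strengthenings, none refutable short of ¬HC.** `P` a projector / `γ` symmetric / one
  `γ` for all `e` at once (projector onto `TW^⊥ ∩ Hdg_ℚ`, definite there): all HC-implied by the F1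
  construction summed over an orthogonal basis. `γ` Hecke: F5. Rationality dropped: FALSE granted HC (F4) —
  the only "kill" in sight, and it is a kill of a statement nobody filed.

* **F7 (PAPER, for the planner) — architecture.** By F5, purity — hence the Hecke envelope — holds for
  theta-type pieces as well (`ψ(Θ(σ)) = ψ(σ)' ⊞ χ_W·R₁`, Adams' conjecture / BMM Part 3: a character at the
  coordinate `0`), so `OrthogonalEnveloped` WITHOUT the hypothesis `e ⊥ TW(D)` has the same intended proof and
  the same single bet (NoImpureRationalComponents). With it, `KernelStep` needs neither `OrthogonalSplit` nor
  `TW(D)`: `Env(all rational Hodge e) + IsotypicMiddleClassesAlgebraic ⟹ MiddleDegreeStep` directly (HC one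
  degree down only for the non-primitive part, which the Hecke envelope handles anyway: `L·A(n-1,n-1)` pieces
  are pure `(n,n)` in degree `2n` by the same count, `b = 3`). The theta world then lives where it is actually
  used — inside the proof of `IsotypicMiddleClassesAlgebraic`, as the source of algebraic SEEDS in the `P`-fixed
  pieces. Not a defect of the current statements (all HC-implied, F1/F1′); an option to thin the route.

Targets (lead's stuck stubs): none yet (payload `stuck_stubs = []`, no line picked for this crux). When the
lead registers a skeleton, its Hecke-formalism stubs (Matsushima pieces, idempotents, purity) are attackable only
through F5's purity count; `CoreVanishing`-type stubs only through `¬HC`.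
-/

noncomputable section

-- The mandated namespace `Summit.<P>.<Sub>.Cruxes.…` repeats `HodgeConjecture` (single-conjunct summit).
set_option linter.dupNamespace false

namespace Summit.HodgeConjecture.HodgeConjecture.Cruxes.OrthogonalEnveloped.Disproof

open CategoryTheory MonoidalCategory CartesianMonoidalCategory
open Literature.AlgebraicGeometry Literature.AlgebraicGeometry.Motives
  Literature.AlgebraicGeometry.HodgeTheory Literature.AlgebraicGeometry.ShimuraVarieties
  Literature.AlgebraicTopology.SingularHomology
open Summit.HodgeConjecture.HodgeConjecture.Theses.EndoscopicMiddleDegree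
  (OrthogonalEnveloped MiddleDegreeStep)
open Summit.HodgeConjecture.HodgeConjecture.Theorems.NikulinSerreCarrier.Negative.OrientationTwist
  (ratFamily isRationalClass_complexGysin_ratFamily)

universe u

variable {m : ℕ} {X : SchemeOver ℂ}

/-! ### Vocabulary: the correspondence action `P`, the fibre integral, the theta world `TW` -/

/-- The correspondence action `P_γ β = pr₁₊(pr₂^* β ∪ γ)` of the crux (`pr₁₊ = complexGysin μ`), for a
smooth projective `X` of dimension `2(m+1)`: it is the tree's `corrAction μ hX hX rfl γ`, and agrees
with the crux's inline `let P` by `rfl` (`p_apply`). [cite: VoisinHodgeII2003, proof of Thm. 10.17 (10.7)] -/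
abbrev Pc (μ : OrientationFamily) (hX : IsSmoothProjective (2 * (m + 1)) X)
    (γ : complexBetti (X ⊗ X) (2 * (2 * (m + 1)))) :
    complexBetti X (2 * (m + 1)) →ₗ[ℂ] complexBetti X (2 * (m + 1)) :=
  corrAction μ hX hX (rfl : 2 * (m + 1) + 2 * (2 * (m + 1)) = 2 * (m + 1) + 2 * (2 * (m + 1))) γ

/-- `Pc` is literally the crux's `P`. [folklore] -/
theorem pc_apply (μ : OrientationFamily) (hX : IsSmoothProjective (2 * (m + 1)) X)
    (γ : complexBetti (X ⊗ X) (2 * (2 * (m + 1)))) (β : complexBetti X (2 * (m + 1))) :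
    Pc μ hX γ β = complexGysin μ (IsSmoothProjective.tensor_holds hX hX) hX (fst X X)
      (show 2 * (m + 1) + 2 * (2 * (m + 1)) + 2 * (2 * (m + 1)) =
        2 * (m + 1) + 2 * (2 * (m + 1) + 2 * (m + 1)) by ring)
      (cupProduct (rfl : 2 * (m + 1) + 2 * (2 * (m + 1)) = 2 * (m + 1) + 2 * (2 * (m + 1)))
        (complexBetti.map (snd X X) (2 * (m + 1)) β) γ) :=
  rfl

/-- The **fibre integral** `H^{top}(X(ℂ)) → H⁰(X(ℂ))`, `ω ↦ pr₁₊ pr₂^* ω`, of the product square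
`X ⊗ X ⇉ X` (base change: `= π^* π_* ω = (∫_X ω) · 1` up to the orientation scalar).
[cite: FultonYoungTableaux1997, Appendix B §B.1 (5)] -/
abbrev fibreIntegral (μ : OrientationFamily) (hX : IsSmoothProjective (2 * (m + 1)) X) :
    complexBetti X (2 * (2 * (m + 1))) →ₗ[ℂ] complexBetti X 0 :=
  complexGysin μ (IsSmoothProjective.tensor_holds hX hX) hX (fst X X)
      (show 2 * (2 * (m + 1)) + 2 * (2 * (m + 1)) = 0 + 2 * (2 * (m + 1) + 2 * (m + 1)) by ring) ∘ₗ
    (complexBetti.map (snd X X) (2 * (2 * (m + 1)))).hom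

/-! ### The ratio of proportional rational classes is rational -/

/-- If `e ≠ 0` and `s • e` are both rational classes then `s ∈ ℚ` (rational descent of linear
relations, `ringChange_mem_span_image_iff`: `ℂ·ι(ℚ x) ∩ ι H(ℚ) = ι(ℚ x)`). [cite: VoisinHodgeI2002, §7.1.1] -/
theorem exists_ratCast_eq_of_isRationalClass_smul {Y : Type u} [TopologicalSpace Y] {k : ℕ}
    {e : singularCohomology ℂ ℂ Y k} (he : IsRationalClass e) (hne : e ≠ 0) {s : ℂ}
    (hs : IsRationalClass (s • e)) : ∃ q : ℚ, (q : ℂ) = s := by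
  obtain ⟨x, rfl⟩ := he.exists_ringChange_eq
  obtain ⟨y, hy⟩ := hs.exists_ringChange_eq
  have hmem : singularCohomology.ringChange (algebraMap ℚ ℂ) Y k y ∈
      Submodule.span ℂ (singularCohomology.ringChange (algebraMap ℚ ℂ) Y k ''
        ((ℚ ∙ x : Submodule ℚ _) : Set (singularCohomology ℚ ℚ Y k))) := by
    rw [hy]
    exact Submodule.smul_mem _ _ (Submodule.subset_span
      ⟨x, Submodule.mem_span_singleton_self x, rfl⟩)
  rw [ringChange_mem_span_image_iff] at hmem
  obtain ⟨q, rfl⟩ := Submodule.mem_span_singleton.1 hmem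
  refine ⟨q, ?_⟩
  rw [ringChange_ratCast_smul] at hy
  have h : ((q : ℂ) - s) • singularCohomology.ringChange (algebraMap ℚ ℂ) Y k x = 0 := by
    rw [sub_smul, hy, sub_self]
  exact sub_eq_zero.1 ((smul_eq_zero.1 h).resolve_right hne)


/-! ### The rank-one correspondence `pr₁^* e ∪ pr₂^* e` -/

/-- `2(m+1) + 2(m+1) = 2·2(m+1)`: the degree of `e ∪ e` written as a top degree `2 · dim X`. [folklore] -/
theorem two_add_two (m : ℕ) : 2 * (m + 1) + 2 * (m + 1) = 2 * (2 * (m + 1)) := by ring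

/-- The exterior square `pr₁^* e ∪ pr₂^* e ∈ H^{4n}((X ⊗ X)(ℂ))` of a middle-degree class `e`
(Voisin II, proof of Prop. 9.20: "`[Z × Z'] = pr_1^*[Z] ∪ pr_2^*[Z']`"). [cite: VoisinHodgeII2003, Prop. 9.20] -/
abbrev crossSq (e : complexBetti X (2 * (m + 1))) : complexBetti (X ⊗ X) (2 * (2 * (m + 1))) :=
  cupProduct (two_add_two m) (complexBetti.map (fst X X) (2 * (m + 1)) e)
    (complexBetti.map (snd X X) (2 * (m + 1)) e)

/-- **`P_{e ⊠ e}(β) = e ∪ pr₁₊ pr₂^*(β ∪ e)`**: `pr₂^*β ∪ (pr₁^*e ∪ pr₂^*e) = pr₁^*e ∪ pr₂^*(β ∪ e)`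
(associativity, graded commutativity in even degrees, multiplicativity of `pr₂^*`) and the projection
formula `pr₁₊(pr₁^* e ∪ y) = e ∪ pr₁₊ y`. [cite: FultonYoungTableaux1997, Appendix B §B.1 (6)]
[cite: HatcherAT2002, §3.2 Prop. 3.10 and Thm. 3.11] -/
theorem pc_crossSq_apply (μ : OrientationFamily) (hX : IsSmoothProjective (2 * (m + 1)) X)
    (e β : complexBetti X (2 * (m + 1))) :
    Pc μ hX (crossSq e) β =
      cupProduct (Nat.add_zero _) e (fibreIntegral μ hX (cupProduct (two_add_two m) β e)) := by
  have hS : 2 * (2 * (m + 1)) + 2 * (m + 1) = 2 * (m + 1) + 2 * (2 * (m + 1)) := by ring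
  have h1 : cupProduct (rfl : 2 * (m + 1) + 2 * (2 * (m + 1)) = 2 * (m + 1) + 2 * (2 * (m + 1)))
      (complexBetti.map (snd X X) (2 * (m + 1)) β) (crossSq e) =
      cupProduct (rfl : 2 * (m + 1) + 2 * (2 * (m + 1)) = 2 * (m + 1) + 2 * (2 * (m + 1)))
        (complexBetti.map (fst X X) (2 * (m + 1)) e)
        (complexBetti.map (snd X X) (2 * (2 * (m + 1))) (cupProduct (two_add_two m) β e)) := by
    rw [crossSq, ← cupProduct_assoc (two_add_two m) (two_add_two m) hS rfl,
      cupProduct_gradedComm_holds ℂ _ (two_add_two m) (two_add_two m)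
        (complexBetti.map (snd X X) (2 * (m + 1)) β) (complexBetti.map (fst X X) (2 * (m + 1)) e),
      show ((-1 : ℂ) ^ (2 * (m + 1) * (2 * (m + 1)))) = 1 by
        rw [show 2 * (m + 1) * (2 * (m + 1)) = 2 * ((m + 1) * (2 * (m + 1))) by ring, pow_mul,
          neg_one_sq, one_pow],
      one_smul, cupProduct_assoc (two_add_two m) (two_add_two m) hS rfl, cupProduct_map]
  rw [pc_apply, h1, complexGysin_cup (OrientationFamily.hasPoincareDuality μ)
    (IsSmoothProjective.tensor_holds hX hX) hX (fst X X) rfl _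
    (show 2 * (2 * (m + 1)) + 2 * (2 * (m + 1)) = 0 + 2 * (2 * (m + 1) + 2 * (m + 1)) by ring)
    (Nat.add_zero _)]
  rfl

/-- Scalar form: `pr₁₊ pr₂^*(β ∪ e) = s · 1` (`H⁰(X(ℂ); ℂ) = ℂ · 1`, `X(ℂ)` connected) and then
`P_{e ⊠ e}(β) = s · e`. [cite: HatcherAT2002, §3.3 Thm. 3.26] -/
theorem exists_pc_crossSq_eq_smul (μ : OrientationFamily) (hX : IsSmoothProjective (2 * (m + 1)) X)
    (e β : complexBetti X (2 * (m + 1))) :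
    ∃ s : ℂ, fibreIntegral μ hX (cupProduct (two_add_two m) β e) =
        s • singularCohomology.one ℂ (ComplexPoints X) ∧
      Pc μ hX (crossSq e) β = s • e := by
  obtain ⟨s, hs⟩ := exists_eq_smul_one μ hX (fibreIntegral μ hX (cupProduct (two_add_two m) β e))
  refine ⟨s, hs, ?_⟩
  rw [pc_crossSq_apply, hs, map_smul, cupProduct_one]

/-- `P_{ratFamily, e ⊠ e}` preserves rational classes for `e` rational (pull-backs, cup products and
the rationally normalised Gysin morphisms preserve rationality). [cite: VoisinHodgeI2002, §7.3.2] -/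
theorem isRationalClass_pc_ratFamily_crossSq (hX : IsSmoothProjective (2 * (m + 1)) X)
    {e β : complexBetti X (2 * (m + 1))} (he : IsRationalClass e) (hβ : IsRationalClass β) :
    IsRationalClass (Pc ratFamily hX (crossSq e) β) := by
  rw [pc_apply]
  exact isRationalClass_complexGysin_ratFamily _ _ _ _
    ((hβ.map _).cup _ ((he.map _).cup _ (he.map _)))

/-- Closed form of the action of a rescaled exterior square: `P_{c • e⊠e} β = c • (e ∪ pr₁₊pr₂^*(β ∪ e))`.
[cite: FultonYoungTableaux1997, Appendix B §B.1 (6)] -/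
theorem pc_smul_crossSq_apply (μ : OrientationFamily) (hX : IsSmoothProjective (2 * (m + 1)) X)
    (c : ℂ) (e β : complexBetti X (2 * (m + 1))) :
    Pc μ hX (c • crossSq e) β =
      c • cupProduct (Nat.add_zero _) e (fibreIntegral μ hX (cupProduct (two_add_two m) β e)) := by
  rw [← pc_crossSq_apply]
  change corrAction μ hX hX rfl (c • crossSq e) β = c • corrAction μ hX hX rfl (crossSq e) β
  rw [map_smul, LinearMap.smul_apply]

/-- **The normalised exterior square of an ALGEBRAIC class (the conclusion of the crux follows from HC).**
Let `X` be smooth projective of dimension `2(m+1)`, `e ∈ H^{2(m+1)}(X(ℂ); ℂ)` rational, ALGEBRAIC, with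
`e ∪ e ≠ 0` (Hodge–Riemann for a primitive `e`; this is where `e ⊥ TW(D)` is used on paper), and assume the
fibre integral `pr₁₊ pr₂^*` is non-zero on `H^{top}(X(ℂ))` (Künneth / `[X × X] = [X] × [X]`). Then for
`c := (pr₁₊pr₂^*(e ∪ e))⁻¹` the class `γ := c • pr₁^* e ∪ pr₂^* e` is algebraic on `X ⊗ X` (exterior products
of algebraic classes) and `P_γ(β) = (⟨β, e⟩ / ⟨e, e⟩) · e` preserves rational classes (the orientation scalar
cancels in the ratio), takes values in `ℂ · e` and fixes `e` — for EVERY orientation family.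
[cite: VoisinHodgeII2003, Prop. 9.20 and proof of Thm. 10.17 (10.7)] [cite: FultonYoungTableaux1997, Appendix B §B.1 (5)–(6)] -/
theorem exists_normalised_crossSq (μ : OrientationFamily) (hX : IsSmoothProjective (2 * (m + 1)) X)
    (ht : ∃ ω : complexBetti X (2 * (2 * (m + 1))), fibreIntegral μ hX ω ≠ 0)
    {e : complexBetti X (2 * (m + 1))} (he : IsRationalClass e)
    (halg : e ∈ algebraicClasses X (m + 1)) (hee : cupProduct (two_add_two m) e e ≠ 0) :
    ∃ c : ℂ, c • crossSq e ∈ algebraicClasses (X ⊗ X) (2 * (m + 1)) ∧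
      (∀ β, IsRationalClass β → IsRationalClass (Pc μ hX (c • crossSq e) β)) ∧
      (∀ β, ∃ s : ℂ, Pc μ hX (c • crossSq e) β = s • e) ∧
      Pc μ hX (c • crossSq e) e = e := by
  classical
  have hμ : μ.HasPoincareDuality := OrientationFamily.hasPoincareDuality μ
  have hne : e ≠ 0 := by rintro rfl; exact hee (by rw [map_zero])
  -- the scalars `s β`: `pr₁₊ pr₂^*(β ∪ e) = s β · 1`, `P₀ β = s β · e`
  choose s hs1 hs2 using exists_pc_crossSq_eq_smul μ hX e
  -- `s e ≠ 0`: `e ∪ e` spans the top line, on which the fibre integral is non-zero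
  obtain ⟨ω, hω⟩ := ht
  have hω0 : ω ≠ 0 := by rintro rfl; exact hω (map_zero _)
  obtain ⟨r, hr⟩ := exists_eq_smul_of_top μ hX hω0 (cupProduct (two_add_two m) e e)
  have hr0 : r ≠ 0 := by rintro rfl; exact hee (by rw [hr, zero_smul])
  have hse : s e ≠ 0 := by
    intro h0
    have h1 := hs1 e
    rw [h0, zero_smul, hr, map_smul] at h1
    exact (smul_ne_zero hr0 hω) h1
  -- comparison with the rationally normalised family: `P₀^μ = c • P₀^{rat}`
  obtain ⟨c, hc0, hc⟩ := corrAction_eq_smul_of_orientationFamily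
    (OrientationFamily.hasPoincareDuality ratFamily) hμ hX hX
    (rfl : 2 * (m + 1) + 2 * (2 * (m + 1)) = 2 * (m + 1) + 2 * (2 * (m + 1)))
  have hrat : ∀ β, IsRationalClass β → ∃ q : ℚ, (q : ℂ) = c⁻¹ * s β := by
    intro β hβ
    refine exists_ratCast_eq_of_isRationalClass_smul he hne ?_
    have h2 : Pc μ hX (crossSq e) β = c • Pc ratFamily hX (crossSq e) β := by
      change corrAction μ hX hX rfl (crossSq e) β = c • corrAction ratFamily hX hX rfl (crossSq e) β
      rw [hc, LinearMap.smul_apply, LinearMap.smul_apply]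
    have h3 : (c⁻¹ * s β) • e = Pc ratFamily hX (crossSq e) β := by
      rw [mul_smul, ← hs2 β, h2, smul_smul, inv_mul_cancel₀ hc0, one_smul]
    rw [h3]
    exact isRationalClass_pc_ratFamily_crossSq hX he hβ
  have h4 : ∀ β, Pc μ hX ((s e)⁻¹ • crossSq e) β = ((s e)⁻¹ * s β) • e := by
    intro β
    change corrAction μ hX hX rfl ((s e)⁻¹ • crossSq e) β = _
    rw [map_smul, LinearMap.smul_apply, mul_smul]
    exact congrArg _ (hs2 β)
  -- the normalised correspondence
  refine ⟨(s e)⁻¹, ?_, ?_, fun β ↦ ⟨_, h4 β⟩, ?_⟩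
  · refine Submodule.smul_mem _ _ ?_
    have h := cupProduct_map_fst_map_snd_mem_supportedClasses hX hX (two_add_two m) halg halg
    rwa [← two_mul] at h
  · intro β hβ
    obtain ⟨qβ, hqβ⟩ := hrat β hβ
    obtain ⟨qe, hqe⟩ := hrat e he
    have hq : ((qβ / qe : ℚ) : ℂ) = (s e)⁻¹ * s β := by
      push_cast
      rw [hqβ, hqe]
      field_simp
    rw [h4, ← hq]
    exact he.smul _
  · rw [h4, inv_mul_cancel₀ hse, one_smul]

/-- **The envelope of an ALGEBRAIC class**: the conclusion of the crux for `e` rational, of type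
`(m+1,m+1)`, algebraic with `e ∪ e ≠ 0`, every orientation family (from `exists_normalised_crossSq`). So a
refutation of the crux produces a non-algebraic rational Hodge class on a ball quotient, i.e. refutes the Hodge
conjecture on the sector. [cite: VoisinHodgeII2003, Prop. 9.20 and proof of Thm. 10.17 (10.7)] -/
theorem conclusion_of_mem_algebraicClasses (μ : OrientationFamily)
    (hX : IsSmoothProjective (2 * (m + 1)) X)
    (ht : ∃ ω : complexBetti X (2 * (2 * (m + 1))), fibreIntegral μ hX ω ≠ 0)
    {e : complexBetti X (2 * (m + 1))} (he : IsRationalClass e)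
    (htyp : IsOfHodgeType (2 * (m + 1)) X (2 * (m + 1)) (m + 1) (m + 1) e)
    (halg : e ∈ algebraicClasses X (m + 1)) (hee : cupProduct (two_add_two m) e e ≠ 0) :
    ∃ γ ∈ algebraicClasses (X ⊗ X) (2 * (m + 1)),
      (∀ β, IsRationalClass β → IsRationalClass (Pc μ hX γ β)) ∧
      (∀ β, IsOfHodgeType (2 * (m + 1)) X (2 * (m + 1)) (m + 1) (m + 1) (Pc μ hX γ β)) ∧
      Pc μ hX γ e = e := by
  obtain ⟨c, hγ, hR, hline, hfix⟩ := exists_normalised_crossSq μ hX ht he halg hee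
  obtain ⟨A, hA⟩ := htyp
  refine ⟨c • crossSq e, hγ, hR, fun β ↦ ⟨A, ?_⟩, hfix⟩
  obtain ⟨s, hs⟩ := hline β
  rw [hs, map_smul]
  exact Submodule.smul_mem _ _ hA

/-! ### F1′ — envelopes from an orthogonal ALGEBRAIC frame (`e ⊥ TW(D)` is not load-bearing for truth) -/

/-- **Envelope of a class in the `ℚ`-span of an orthogonal algebraic frame.** Let `f₁, …, f_r` be rational,
ALGEBRAIC classes of type `(m+1,m+1)` in one Hodge model, pairwise cup-orthogonal, with `fᵢ ∪ fᵢ ≠ 0` (an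
anisotropic orthogonal basis — every non-degenerate `ℚ`-quadratic space has one). Then every `ℚ`-combination
`e = Σ aᵢ fᵢ` is enveloped: `γ := Σ cᵢ • (pr₁^*fᵢ ∪ pr₂^*fᵢ)` is algebraic and `P_γ = Σ P_{γᵢ}` preserves
rational classes, is `(m+1,m+1)`-valued and fixes `e` (the cross terms `P_{γᵢ} f_k`, `k ≠ i`, vanish by
`pc_smul_crossSq_apply`), for EVERY orientation family. With HC on `X` in degree `2(m+1)` and the
non-degeneracy of the cup pairing on `Hdg_ℚ` (Hodge–Riemann on the rational Lefschetz pieces) this envelopes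
EVERY rational Hodge class: the hypothesis `e ⊥ TW(D)` of the crux is not load-bearing for its TRUTH (F4) —
only for the route's Hecke proof and for the seeds of `IsotypicMiddleClassesAlgebraic`.
[cite: VoisinHodgeI2002, Thm. 6.32 and §11.3] [cite: VoisinHodgeII2003, Prop. 9.20] -/
theorem conclusion_of_orthogonalFrame (μ : OrientationFamily) (hX : IsSmoothProjective (2 * (m + 1)) X)
    (ht : ∃ ω : complexBetti X (2 * (2 * (m + 1))), fibreIntegral μ hX ω ≠ 0) {r : ℕ}
    (f : Fin r → complexBetti X (2 * (m + 1))) (hrat : ∀ i, IsRationalClass (f i))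
    (halg : ∀ i, f i ∈ algebraicClasses X (m + 1)) (A : HodgeModel (2 * (m + 1)) X)
    (htyp : ∀ i, A.pullback (2 * (m + 1)) (f i) ∈ A.hodgePQ (2 * (m + 1)) (m + 1) (m + 1))
    (horth : ∀ i j, i ≠ j → cupProduct (two_add_two m) (f i) (f j) = 0)
    (hdiag : ∀ i, cupProduct (two_add_two m) (f i) (f i) ≠ 0) (a : Fin r → ℚ) :
    ∃ γ ∈ algebraicClasses (X ⊗ X) (2 * (m + 1)),
      (∀ β, IsRationalClass β → IsRationalClass (Pc μ hX γ β)) ∧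
      (∀ β, IsOfHodgeType (2 * (m + 1)) X (2 * (m + 1)) (m + 1) (m + 1) (Pc μ hX γ β)) ∧
      Pc μ hX γ (∑ i, ((a i : ℚ) : ℂ) • f i) = ∑ i, ((a i : ℚ) : ℂ) • f i := by
  classical
  choose c hc1 hc2 hc3 hc4 using fun i ↦ exists_normalised_crossSq μ hX ht (hrat i) (halg i) (hdiag i)
  -- the sum of the single envelopes and its action
  have hsum : ∀ β, Pc μ hX (∑ i, c i • crossSq (f i)) β = ∑ i, Pc μ hX (c i • crossSq (f i)) β := by
    intro β
    change corrAction μ hX hX rfl (∑ i, c i • crossSq (f i)) β = _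
    rw [map_sum, LinearMap.sum_apply]
  -- cross terms vanish
  have hcross : ∀ i k, i ≠ k → Pc μ hX (c i • crossSq (f i)) (f k) = 0 := by
    intro i k hik
    rw [pc_smul_crossSq_apply, horth k i (Ne.symm hik), map_zero, map_zero, smul_zero]
  have hfix : ∀ k, Pc μ hX (∑ i, c i • crossSq (f i)) (f k) = f k := by
    intro k
    rw [hsum, Finset.sum_eq_single k (fun i _ hik ↦ hcross i k hik) (fun h ↦ (h (Finset.mem_univ k)).elim),
      hc4 k]
  -- finite sums of rational classes are rational
  have hratsum : ∀ (g : Fin r → complexBetti X (2 * (m + 1))), (∀ i, IsRationalClass (g i)) →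
      IsRationalClass (∑ i, g i) := by
    intro g hg
    have h := IsRationalClass.sum_smul Finset.univ hg (fun _ ↦ (1 : ℚ))
    simpa only [Rat.cast_one, one_smul] using h
  refine ⟨∑ i, c i • crossSq (f i), Submodule.sum_mem _ fun i _ ↦ hc1 i, ?_, ?_, ?_⟩
  · intro β hβ
    rw [hsum]
    exact hratsum _ fun i ↦ hc2 i β hβ
  · intro β
    refine ⟨A, ?_⟩
    rw [hsum, map_sum]
    refine Submodule.sum_mem _ fun i _ ↦ ?_
    obtain ⟨t, hts⟩ := hc3 i β
    rw [hts, map_smul]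
    exact Submodule.smul_mem _ _ (htyp i)
  · rw [map_sum]
    refine Finset.sum_congr rfl fun k _ ↦ ?_
    rw [map_smul, hfix k]

/-! ### The crux, unfolded: theta world, orthogonality, conclusion -/

/-- The **theta world** `TW(D) = SCⁿ(D) ⊔ SConⁿ(D) ⊔ Hdg^{m,m}_ℚ · N¹` of the crux (verbatim: classes
supported on codimension-`n` special cycles; classes supported on codimension-`n` closed subsets of
codimension-`m` special cycles; products of rational Hodge `(m,m)`-classes with `N¹H²`), `n = m + 1`.
[cite: BergeronMillsonMoeglin2016Balls, Introduction §1.7] -/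
abbrev TW (D : UnitaryBallQuotientDatum (2 * (m + 1)) X) :
    Submodule ℂ (complexBetti X (2 * (m + 1))) :=
  ((⨆ (W : Submodule D.E (Fin (2 * (m + 1) + 1) → D.E))
      (_ : IsTotallyPositive (conjRingHom D.E) D.H W) (_ : Module.finrank D.E W = m + 1),
      classesSupportedOn X (D.specialSubvariety W) (2 * (m + 1))) ⊔
    (⨆ (W : Submodule D.E (Fin (2 * (m + 1) + 1) → D.E))
      (_ : IsTotallyPositive (conjRingHom D.E) D.H W) (_ : Module.finrank D.E W = m)
      (Z : Set X.left) (_ : IsClosed Z) (_ : Z ⊆ D.specialSubvariety W)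
      (_ : ∀ z ∈ Z, ((m + 1 : ℕ) : ℕ∞) ≤ Order.coheight z), classesSupportedOn X Z (2 * (m + 1))) ⊔
    Submodule.span ℂ {z : complexBetti X (2 * (m + 1)) | ∃ a : complexBetti X (2 * m),
      IsRationalClass a ∧ IsOfHodgeType (2 * (m + 1)) X (2 * m) m m a ∧
      ∃ d ∈ algebraicClasses X 1, z = cupProduct (two_mul_add_two_mul m 1) a d})

/-- `e` is **cup-orthogonal to the theta world**: `e ∪ x = 0` in `H^{4n}(X(ℂ))` for all `x ∈ TW(D)`.
[cite: BergeronMillsonMoeglin2016Balls, Introduction §1.7] -/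
def IsOrthTW (D : UnitaryBallQuotientDatum (2 * (m + 1)) X) (e : complexBetti X (2 * (m + 1))) :
    Prop :=
  ∀ x ∈ TW D, cupProduct (two_mul_add_two_mul (m + 1) (m + 1)) e x = 0

/-- The **conclusion of the crux** for `(μ, D, e)`: an algebraic `γ` on `X ⊗ X` whose action `P_γ`
preserves rational classes, has purely `(n,n)` image and fixes `e`. [cite: VoisinHodgeII2003, proof of Thm. 10.17 (10.7)] -/
def Concl (μ : OrientationFamily) (D : UnitaryBallQuotientDatum (2 * (m + 1)) X)
    (e : complexBetti X (2 * (m + 1))) : Prop :=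
  ∃ γ ∈ algebraicClasses (X ⊗ X) (2 * (m + 1)),
    (∀ β, IsRationalClass β → IsRationalClass (Pc μ D.isSmoothProjective γ β)) ∧
    (∀ β, IsOfHodgeType (2 * (m + 1)) X (2 * (m + 1)) (m + 1) (m + 1)
      (Pc μ D.isSmoothProjective γ β)) ∧
    Pc μ D.isSmoothProjective γ e = e

/-- **The crux unfolded** (`Iff.rfl`): `OrthogonalEnveloped` says that for every orientation family
with Poincaré duality, `m ∈ {1, 2}`, datum `D` and rational `(n,n)`-class `e ⊥ TW(D)`, `Concl μ D e`.
[cite: BergeronMillsonMoeglin2016Balls, Introduction §1.7] -/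
theorem orthogonalEnveloped_iff : OrthogonalEnveloped ↔
    ∀ (μ : OrientationFamily), μ.HasPoincareDuality → ∀ (m : ℕ) (X : SchemeOver ℂ)
      (D : UnitaryBallQuotientDatum (2 * (m + 1)) X), 1 ≤ m → m ≤ 2 →
      ∀ e : complexBetti X (2 * (m + 1)), IsRationalClass e →
        IsOfHodgeType (2 * (m + 1)) X (2 * (m + 1)) (m + 1) (m + 1) e → IsOrthTW D e →
        Concl μ D e :=
  Iff.rfl

/-- **FINDING F2 — the Poincaré-duality hypothesis is free**: every orientation family has Poincaré
duality (`OrientationFamily.hasPoincareDuality`, Hatcher Thm. 3.30 proved in the tree), so the crux is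
equivalent to its `hμ`-free form. [cite: HatcherAT2002, §3.3 Thm. 3.30] -/
theorem orthogonalEnveloped_iff_noPD : OrthogonalEnveloped ↔
    ∀ (μ : OrientationFamily) (m : ℕ) (X : SchemeOver ℂ)
      (D : UnitaryBallQuotientDatum (2 * (m + 1)) X), 1 ≤ m → m ≤ 2 →
      ∀ e : complexBetti X (2 * (m + 1)), IsRationalClass e →
        IsOfHodgeType (2 * (m + 1)) X (2 * (m + 1)) (m + 1) (m + 1) e → IsOrthTW D e →
        Concl μ D e :=
  ⟨fun h μ ↦ h μ (OrientationFamily.hasPoincareDuality μ), fun h μ _ ↦ h μ⟩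

/-- **`e = 0` is enveloped by `γ = 0`** (given a Hodge model, which the hypothesis `IsOfHodgeType e`
supplies): the vacuity direction — were `TW(D)^⊥ ∩ Hdg_ℚ = 0` the crux would close trivially.
[cite: VoisinHodgeI2002, §7.1.1] -/
theorem concl_zero (μ : OrientationFamily) (D : UnitaryBallQuotientDatum (2 * (m + 1)) X)
    (A : HodgeModel (2 * (m + 1)) X) : Concl μ D 0 := by
  have h0 : Pc μ D.isSmoothProjective 0 = 0 := map_zero _
  refine ⟨0, Submodule.zero_mem _, fun β _ ↦ ?_, fun β ↦ ?_, ?_⟩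
  · rw [h0, LinearMap.zero_apply]; exact IsRationalClass.zero
  · rw [h0, LinearMap.zero_apply]; exact IsOfHodgeType.zero A _ _ _
  · rw [h0, LinearMap.zero_apply]

/-- **FINDING F3 — the `∀ μ : OrientationFamily` quantifier is harmless here** (contrast crux
`NikulinSerreCarrier`, where it was fatal): the conclusion at one family is equivalent to the
conclusion at any other, because `corrAction μ' = c • corrAction μ` (`c ≠ 0`) and `γ ↦ c • γ`
preserves `algebraicClasses`, a `ℂ`-subspace. Provers may fix `μ := ratFamily`.
[cite: FultonYoungTableaux1997, Appendix B §B.1 (5)] -/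
theorem concl_of_concl {μ μ' : OrientationFamily} {D : UnitaryBallQuotientDatum (2 * (m + 1)) X}
    {e : complexBetti X (2 * (m + 1))} (h : Concl μ D e) : Concl μ' D e := by
  obtain ⟨γ, hγ, hR, hT, hfix⟩ := h
  obtain ⟨c, -, hc⟩ := corrAction_eq_smul_of_orientationFamily
    (OrientationFamily.hasPoincareDuality μ') (OrientationFamily.hasPoincareDuality μ)
    D.isSmoothProjective D.isSmoothProjective
    (rfl : 2 * (m + 1) + 2 * (2 * (m + 1)) = 2 * (m + 1) + 2 * (2 * (m + 1)))
  have key : Pc μ' D.isSmoothProjective (c • γ) = Pc μ D.isSmoothProjective γ := by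
    change corrAction μ' _ _ rfl (c • γ) = corrAction μ _ _ rfl γ
    rw [map_smul, hc, LinearMap.smul_apply]
  refine ⟨c • γ, Submodule.smul_mem _ _ hγ, ?_, ?_, ?_⟩
  · intro β hβ; rw [key]; exact hR β hβ
  · intro β; rw [key]; exact hT β
  · rw [key]; exact hfix

/-- Orientation-freeness as an equivalence. [cite: FultonYoungTableaux1997, Appendix B §B.1 (5)] -/
theorem concl_iff_of_orientationFamily (μ μ' : OrientationFamily)
    (D : UnitaryBallQuotientDatum (2 * (m + 1)) X) (e : complexBetti X (2 * (m + 1))) :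
    Concl μ D e ↔ Concl μ' D e :=
  ⟨concl_of_concl, concl_of_concl⟩

/-! ### FINDING F1 — the crux follows from the Hodge conjecture on the sector -/

/-- **`OrthogonalEnveloped` ⟸ HC in the middle degree of the sector** (modulo two textbook facts made
explicit as hypotheses): (`hK`) the fibre integral `pr₁₊ pr₂^* : H^{4n}(X(ℂ)) → H⁰(X(ℂ))` of
`X ⊗ X ⇉ X` is non-zero (Künneth, `[X × X] = [X] × [X]`, Hatcher Thm. 3.15 / 3B.6); (`hHR`) a
non-zero rational `(n,n)`-class cup-orthogonal to `TW(D)` has `e ∪ e ≠ 0` (it is primitive since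
`TW(D) ⊇ L · Hdg^{n-1,n-1}_ℚ`, and Hodge–Riemann, Voisin I Thm. 6.32); (`hHC`) every rational
`(n,n)`-class on a variety carrying a datum is algebraic, `n = m + 1 ∈ {2,3}` — LITERALLY the
conclusion of the route's target `MiddleDegreeStep`. Consequence for the disprover: an unconditional
`¬ OrthogonalEnveloped` is a non-algebraic rational Hodge class on a compact ball-quotient 4- or
6-fold, i.e. `¬ HC`; the crux cannot be refuted "cheaply", and it is NECESSARY for the target.
[cite: VoisinHodgeI2002, Thm. 6.32 and §11.3] [cite: HatcherAT2002, §3.2 Thm. 3.15]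
[cite: VoisinHodgeII2003, Prop. 9.20] -/
theorem orthogonalEnveloped_of_middleHC
    (hK : ∀ (μ : OrientationFamily) (m : ℕ) (X : SchemeOver ℂ)
      (hX : IsSmoothProjective (2 * (m + 1)) X),
      ∃ ω : complexBetti X (2 * (2 * (m + 1))), fibreIntegral μ hX ω ≠ 0)
    (hHR : ∀ (m : ℕ) (X : SchemeOver ℂ) (D : UnitaryBallQuotientDatum (2 * (m + 1)) X)
      (e : complexBetti X (2 * (m + 1))), 1 ≤ m → m ≤ 2 → IsRationalClass e →
      IsOfHodgeType (2 * (m + 1)) X (2 * (m + 1)) (m + 1) (m + 1) e → IsOrthTW D e → e ≠ 0 →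
      cupProduct (two_add_two m) e e ≠ 0)
    (hHC : ∀ (m : ℕ) (X : SchemeOver ℂ), Nonempty (UnitaryBallQuotientDatum (2 * (m + 1)) X) →
      1 ≤ m → m ≤ 2 → ∀ e : complexBetti X (2 * (m + 1)), IsRationalClass e →
      IsOfHodgeType (2 * (m + 1)) X (2 * (m + 1)) (m + 1) (m + 1) e →
      e ∈ algebraicClasses X (m + 1)) :
    OrthogonalEnveloped := by
  rw [orthogonalEnveloped_iff]
  intro μ _ m X D h1 h2 e he htyp horth
  by_cases hne : e = 0
  · subst hne
    obtain ⟨A, -⟩ := htyp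
    exact concl_zero μ D A
  · exact conclusion_of_mem_algebraicClasses μ D.isSmoothProjective (hK μ m X _) he htyp
      (hHC m X ⟨D⟩ h1 h2 e he htyp) (hHR m X D e h1 h2 he htyp horth hne)

/-- **The crux is implied by the route's TARGET** `MiddleDegreeStep` together with the target's own
hypothesis (HC one degree down on the sector: Lefschetz `(1,1)` at `m = 1`, BMM Cor. 2 at `m = 2`) and
the two textbook facts `hK`, `hHR`. So `OrthogonalEnveloped` is a NECESSARY waypoint, refutable only
together with the target. [cite: BergeronMillsonMoeglin2016Balls, Introduction Cor. 2]
[cite: VoisinHodgeI2002, Thm. 6.32] -/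
theorem orthogonalEnveloped_of_middleDegreeStep
    (hK : ∀ (μ : OrientationFamily) (m : ℕ) (X : SchemeOver ℂ)
      (hX : IsSmoothProjective (2 * (m + 1)) X),
      ∃ ω : complexBetti X (2 * (2 * (m + 1))), fibreIntegral μ hX ω ≠ 0)
    (hHR : ∀ (m : ℕ) (X : SchemeOver ℂ) (D : UnitaryBallQuotientDatum (2 * (m + 1)) X)
      (e : complexBetti X (2 * (m + 1))), 1 ≤ m → m ≤ 2 → IsRationalClass e →
      IsOfHodgeType (2 * (m + 1)) X (2 * (m + 1)) (m + 1) (m + 1) e → IsOrthTW D e → e ≠ 0 →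
      cupProduct (two_add_two m) e e ≠ 0)
    (hlow : ∀ (m : ℕ) (X : SchemeOver ℂ), Nonempty (UnitaryBallQuotientDatum (2 * (m + 1)) X) →
      1 ≤ m → m ≤ 2 → ∀ a : complexBetti X (2 * m), IsRationalClass a →
      IsOfHodgeType (2 * (m + 1)) X (2 * m) m m a → a ∈ algebraicClasses X m)
    (h : MiddleDegreeStep) : OrthogonalEnveloped :=
  orthogonalEnveloped_of_middleHC hK hHR
    (fun m X hD h1 h2 e he ht ↦ h m X h1 h2 hD (hlow m X hD h1 h2) e he ht)

/-- **The partner crux is HC-implied too**: `IsotypicMiddleClassesAlgebraic` (stmt-HodgeConjecture-14301)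
follows from HC in the middle degree on the sector with NO further input — a rational `c` with `P c = c` and
`P` purely `(n,n)`-valued is a rational Hodge class. So the pair (`OrthogonalEnveloped`,
`IsotypicMiddleClassesAlgebraic`) is refutable only together with HC on the sector (F1 (ii)).
[cite: Deligne2000, §1] -/
theorem isotypicMiddleClassesAlgebraic_of_middleHC
    (hHC : ∀ (m : ℕ) (X : SchemeOver ℂ), Nonempty (UnitaryBallQuotientDatum (2 * (m + 1)) X) →
      1 ≤ m → m ≤ 2 → ∀ e : complexBetti X (2 * (m + 1)), IsRationalClass e →
      IsOfHodgeType (2 * (m + 1)) X (2 * (m + 1)) (m + 1) (m + 1) e →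
      e ∈ algebraicClasses X (m + 1)) :
    Summit.HodgeConjecture.HodgeConjecture.Theses.EndoscopicMiddleDegree.IsotypicMiddleClassesAlgebraic := by
  intro μ _ m X D h1 h2 γ _ P _ hT c hc hfix
  exact hHC m X ⟨D⟩ h1 h2 c hc (hfix ▸ hT c)

/-! ### FINDING F4 — load-bearing hypotheses: `IsOfHodgeType e` and `IsRationalClass e` -/

/-- The crux with the HODGE-TYPE hypothesis on `e` dropped. [cite: Deligne2000, §1] -/
def WithoutHodgeType : Prop :=
  ∀ (μ : OrientationFamily), μ.HasPoincareDuality → ∀ (m : ℕ) (X : SchemeOver ℂ)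
    (D : UnitaryBallQuotientDatum (2 * (m + 1)) X), 1 ≤ m → m ≤ 2 →
    ∀ e : complexBetti X (2 * (m + 1)), IsRationalClass e → IsOrthTW D e → Concl μ D e

/-- **Hypothesis `H_T` (a transcendental rational class off the theta world)**: some datum carries a
rational class `e ⊥ TW(D)` NOT of type `(n,n)`. On paper this holds for every datum with
`H^{2n}(X) ≠ H^{n,n}(X)` (e.g. `h^{2n,0} = dim S_{2n+1}(Γ) ≠ 0`, true at deep level): `TW(D)` is spanned
by rational classes and lies in `Hdg_ℚ ⊗ ℂ`, the cup pairing is non-degenerate on `TW_ℚ`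
(Hodge–Riemann), so `H_ℚ = TW_ℚ ⊕ TW_ℚ^⊥` and `TW_ℚ^⊥ ⊄ Hdg_ℚ`. Not constructible in the tree (no datum
exists as a `Scheme`). [cite: VoisinHodgeI2002, Thm. 6.32] [cite: BergeronMillsonMoeglin2016Balls, Introduction §1.7] -/
def HasTranscendentalOrthClass : Prop :=
  ∃ (m : ℕ) (X : SchemeOver ℂ) (D : UnitaryBallQuotientDatum (2 * (m + 1)) X)
    (e : complexBetti X (2 * (m + 1))), 1 ≤ m ∧ m ≤ 2 ∧ IsRationalClass e ∧ IsOrthTW D e ∧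
    ¬ IsOfHodgeType (2 * (m + 1)) X (2 * (m + 1)) (m + 1) (m + 1) e

/-- **`IsOfHodgeType e` is load-bearing (modulo `H_T`)**: `P` has purely `(n,n)` image and fixes `e`,
so `e` itself is `(n,n)`. [cite: Deligne2000, §1] -/
theorem withoutHodgeType_false_of_hasTranscendentalOrthClass (h : HasTranscendentalOrthClass) :
    ¬ WithoutHodgeType := by
  intro hW
  obtain ⟨m, X, D, e, h1, h2, he, horth, hnot⟩ := h
  obtain ⟨γ, -, -, hT, hfix⟩ := hW ratFamily (OrientationFamily.hasPoincareDuality _) m X D h1 h2 e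
    he horth
  exact hnot (hfix ▸ hT e)

/-- The crux with the RATIONALITY hypothesis on `e` dropped. [cite: Deligne2000, §1] -/
def WithoutRational : Prop :=
  ∀ (μ : OrientationFamily), μ.HasPoincareDuality → ∀ (m : ℕ) (X : SchemeOver ℂ)
    (D : UnitaryBallQuotientDatum (2 * (m + 1)) X), 1 ≤ m → m ≤ 2 →
    ∀ e : complexBetti X (2 * (m + 1)),
      IsOfHodgeType (2 * (m + 1)) X (2 * (m + 1)) (m + 1) (m + 1) e → IsOrthTW D e → Concl μ D e

/-- **Hypothesis `H_R` (an `(n,n)`-class off the theta world outside the span of the rational Hodge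
classes)**: some datum carries `e ∈ H^{n,n} ∩ TW(D)^⊥` with `e ∉ Hdg_ℚ ⊗ ℂ`. On paper: any datum whose
`H^{2n}` contains a CORE piece `N` (stable tempered parameter `Ψ_{2n+1}` with `A(n,n)` at `τ₁`; they
exist at deep level by limit multiplicity, Marshall–Shin / Savin) has `N^{n,n} ≠ 0`, `N ⊥ TW(D)` (F5/F6′
of `Cruxes/MiddleThetaSpan/Disproof.lean`: the span is theta-isotypic), and `N^{n,n} ⊄ Hdg_ℚ ⊗ ℂ` unless
`N` carries rational Hodge classes — which HC forbids (no Tate companions, Calegari–Gee irreducibility).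
So `H_R` holds GRANTED HC; the rationality-free crux is false if HC is true.
[cite: arXiv:1804.05047, Thm. 1.2] [cite: arXiv:1306.1515, Thm. 61] -/
def HasNonRationalSpanOrthClass : Prop :=
  ∃ (m : ℕ) (X : SchemeOver ℂ) (D : UnitaryBallQuotientDatum (2 * (m + 1)) X)
    (e : complexBetti X (2 * (m + 1))), 1 ≤ m ∧ m ≤ 2 ∧
    IsOfHodgeType (2 * (m + 1)) X (2 * (m + 1)) (m + 1) (m + 1) e ∧ IsOrthTW D e ∧
    e ∉ Submodule.span ℂ {a : complexBetti X (2 * (m + 1)) | IsRationalClass a ∧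
      IsOfHodgeType (2 * (m + 1)) X (2 * (m + 1)) (m + 1) (m + 1) a}

/-- **`IsRationalClass e` is load-bearing (modulo `H_R`)**: `P` maps `H_ℚ` into `Hdg_ℚ`, the rational
classes span `H^{2n}(X(ℂ); ℂ)` (`span_isRationalClass_eq_top_of_isSmoothProjective_holds`), so `P`
maps everything into `Hdg_ℚ ⊗ ℂ`, and `P e = e`. [cite: VoisinHodgeI2002, §7.1.1] -/
theorem withoutRational_false_of_hasNonRationalSpanOrthClass (h : HasNonRationalSpanOrthClass) :
    ¬ WithoutRational := by
  intro hW
  obtain ⟨m, X, D, e, h1, h2, htyp, horth, hnot⟩ := h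
  obtain ⟨γ, -, hR, hT, hfix⟩ := hW ratFamily (OrientationFamily.hasPoincareDuality _) m X D h1 h2 e
    htyp horth
  apply hnot
  rw [← hfix]
  have hspan : e ∈ Submodule.span ℂ {c : complexBetti X (2 * (m + 1)) | IsRationalClass c} := by
    rw [span_isRationalClass_eq_top_of_isSmoothProjective_holds _ X D.isSmoothProjective]
    exact Submodule.mem_top
  have key : Submodule.span ℂ {c : complexBetti X (2 * (m + 1)) | IsRationalClass c} ≤
      (Submodule.span ℂ {a : complexBetti X (2 * (m + 1)) | IsRationalClass a ∧
        IsOfHodgeType (2 * (m + 1)) X (2 * (m + 1)) (m + 1) (m + 1) a}).comap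
        (Pc ratFamily D.isSmoothProjective γ) :=
    Submodule.span_le.2 fun c hc ↦ Submodule.subset_span ⟨hR c hc, hT c⟩
  exact key hspan

end Summit.HodgeConjecture.HodgeConjecture.Cruxes.OrthogonalEnveloped.Disproof

end
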